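/-
Copyright (c) 2026. All rights reserved.
Released under Apache 2.0 license as described in the file LICENSE.
Authors: abc-iut cell, seat abc-iut-L4-t9 (gen 7; [AbsTopIII] Prop 3.2 (iii)/(v) on the `T`-isomorphism
subcategories `𝒞̲` of Def 3.1 (iii)).
-/
import Literature.AnabelianGeometry.AbsoluteAnabelian.MLFGaloisLogFrobeniusResidualProofs
import Literature.AnabelianGeometry.AbsoluteAnabelian.MLFGaloisSubcategoriesProofs

/-!
# [AbsTopIII] Prop 3.2 (iii)/(v) on print's carrier `𝒞̲^{MLF}_T`: the `T`-ISOMORPHISM subcategories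

S. Mochizuki, *Topics in absolute anabelian geometry III* [MochizukiAbsTopIII2015] (kurims manuscript
`paper:url-5493eb38cbb7`, read on the page; cell render `lit/renders/AbsTopIII-kurims-url-5493eb38cbb7`).
Def 3.1 (ii) p. 67 l. 34–41: "A morphism of MLF-Galois `T`-pairs `φ : (Π₁ ↷ M₁) → (Π₂ ↷ M₂)` consists of a
morphism of objects `φ_M : M₁ → M₂` of `T`, together with a compatible [...] continuous homomorphism of
topological groups `φ_Π : Π₁ → Π₂` that induces an open injective homomorphism between the respective
arithmetic Galois groups; if, in this situation, `φ_M` (respectively, `φ_Π`) is an isomorphism, then we shall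
refer to `φ` as a `T`-isomorphism (respectively, Galois-isomorphism)."  Def 3.1 (iii) p. 67 l. 46–50: "we
shall use the same notation, except with `𝒞` replaced by `𝒞̲` (respectively, [overlined] `𝒞`; [doubly
underlined] `𝒞`) to denote the various subcategories determined by the `T`-isomorphisms (respectively,
Galois-isomorphisms; isomorphisms)".  Prop 3.2 (iii) p. 72 l. 7–16: "Suppose that `(Π ↷ M_T)` is of strictly
Belyi type.  Then the construction of Corollary 1.10, (h), determines an additive structure [...] In particular,
these constructions yield a functorial [i.e., relative to `𝒞̲^MLF_T`, in the evident sense — cf. Remark 3.2.2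
below] algorithm for constructing this topological field structure." — the `𝒞` of (iii) is SINGLE-UNDERLINED in
print (= `T`-isomorphisms; the renders drop underlines: stroke at x 470.4, y 569.8 of the p. 72 content stream,
read by seat abc-iut-L6-t21, memo `staging/L4/abc-iut-L6-t21/A21g7-E-L4-10-underline-read.md`), while the DISPLAY
of (v) p. 72 l. 40–53 ("The algorithm of (iii) yields a natural [1-]factorization `𝒞^{MLF-sB}_TF ⟶ 𝒞^{MLF-sB}_T
⟶^{𝔩𝔬𝔤_{T,T′}} 𝒞^{MLF-sB}_{T′}` [...] Moreover, the functor `𝔩𝔬𝔤_{T,T}` is isomorphic to the identity functor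
[hence, in particular, is an equivalence of categories]") is plain.  Rmk 3.2.2 p. 73 l. 21–30: functoriality
"relative to dividing [...] by a factor given by the index of the image of the induced open homomorphism".

THIS FILE = the carrier print licenses, between this seat's `MLFGaloisLogFrobeniusFactorization.lean` (plain
`𝒞`, ALL Def 3.1 (ii) morphisms: `Prop32iiiAlgorithm S` UNINHABITABLE for inhabited `S` by the power
endomorphisms `(𝟙_Π, x ↦ xⁿ)`, finding E-L4-10) and `MLFGaloisLogFrobeniusFactorizationIso.lean` (`𝒞̳` = Mathlib
`Core`, BOTH components isomorphisms: `Prop32iiiAlgorithmIso S`, residual `(tfToTMOnCore S).Full` = F-2995|`S` by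
`MLFGaloisLogFrobeniusResidualProofs.lean`): `Core ⊆ 𝒞̲ ⊆ 𝒞`, `𝒞̲` = `φ_M` an ISOMORPHISM of `T`, `φ_Π` merely
continuous inducing an open injection of arithmetic Galois groups.  Over abc-iut-L4-t2's morphism properties
`GaloisFieldPair.tIso` / `GaloisMonoidPair.tIso` (`MLFGaloisSubcategories.lean`, by name via
`MorphismProperty.inverseImage`): (a) `GaloisFieldPair.Hom.isTIso_integers` — a `T`-isomorphism of `TF`-pairs
restricts to a `T`-isomorphism of the integer pairs (`φ_M⁻¹` pulls `Stab`-fixed `ℓⁿ`-th roots back; FORMAL, no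
local field theory); (b) the carrier `MLFGaloisFieldPairTIsoCatOn S` = `𝒞̲^{S}_TF`, `MLFGaloisTMPairTIsoCatOn S` =
`𝒞̲^{S}_TM` (`S : ObjectProperty 𝒞^c_TF` standing for "of strictly Belyi type", as in the lineage's files) and
`tfToTMOnTIso S : 𝒞̲^{S}_TF ⥤ 𝒞̲^{S}_TM`, FAITHFUL and ESSENTIALLY SURJECTIVE unconditionally; (c)
`Prop32iiiAlgorithmTIso S` — "the algorithm of (iii)", functorial "relative to `𝒞̲`", as DATA: a PARAMETER, NOT
constructed, NOT asserted (intended instance for strictly Belyi type: Cor 1.10 (h) with the functoriality of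
Rmk 1.10.1 / 3.2.2 — campaign L), and over it the printed sentences of (v) (`equivalence`, `𝔩𝔬𝔤_{TM,T′}` with
the plain targets as displayed, `factorTF/TM/TLG/TCG`, `mlfLogFrobeniusTMToTMIsoId`, `isEquivalence_…`); (d) the
residual `nonempty_prop32iiiAlgorithmTIso_iff_full`; (e) ONE-WAY `full_tfToTMOnCore_of_full_tfToTMOnTIso`, hence
`galoisIsoLiftsToTFPairIso_of_full_tfToTMOnTIso` (universe `0`): the `𝒞̲`-datum IMPLIES F-2995|`S` — THE
CONVERSE IS NOT CLAIMED: `𝒞̲`-fullness also covers NON-surjective `φ_Π` (the "up to the index" functoriality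
of Rmk 3.2.2 / 1.10.1), which F-2995 (isomorphisms `Π ⥲ Π*`) does not speak to (remark of abc-iut-L6-t21,
adopted); (f) the E-L4-10 CHECK `not_isTIso_powEnd_two` / `not_tmTIsoOn_powEnd_two`: the obstructing
endomorphisms of the plain carrier are NOT morphisms of `𝒞̲`.

HONEST FRAMING: refereed pre-IUT material; (a), (e), (f) are OUR kernel theorems about OUR typings, (b)–(d) formal
category theory over an explicit parameter whose intended instance is a campaign-L input, neither asserted nor
refuted: bookkeeping, not a discharge.  No instance, no notation.  No bearing on [IUTchIII] Cor 3.12; typed ≠ proved.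
-/

noncomputable section

universe u

namespace Literature.AnabelianGeometry.AbsoluteAnabelian

open _root_.CategoryTheory

/-! ## (a) A `T`-isomorphism of `TF`-pairs restricts to a `T`-isomorphism of the integer pairs -/

namespace GaloisFieldPair

variable {P Q : GaloisFieldPair.{u}}

/-- **Intrinsic units pull back along a morphism with surjective `φ_M`**: the `Stab`-fixed `ℓⁿ`-th roots of
`φ_M(x)` (Rmk 3.1.1) pull back along `φ_M` to roots of `x` fixed by `Stab(x)`, since `φ_Π(Stab x) ⊆ Stab(φ_M x)`
(equivariance) and `φ_M` is injective.  Formal. [cite: MochizukiAbsTopIII2015, Remark 3.1.1 p.70] -/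
theorem Hom.isIntrinsicUnit_of_map (φ : P.Hom Q) (hφ : Function.Surjective φ.homM) {x : P.M}
    (hx : Q.IsIntrinsicUnit (φ.homM x)) : P.IsIntrinsicUnit x := by
  obtain ⟨h0, ℓ, hℓ, hroots⟩ := hx
  refine ⟨fun hx0 => h0 (by rw [hx0, map_zero]), ℓ, hℓ, fun n => ?_⟩
  obtain ⟨z, hz, hzx⟩ := hroots n
  obtain ⟨w, rfl⟩ := hφ z
  refine ⟨w, fun g hg => ?_, ?_⟩
  · apply φ.homM.injective
    rw [φ.smul_comm]
    apply hz
    rw [← φ.smul_comm, hg]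
  · apply φ.homM.injective
    rw [map_pow, hzx]

/-- Intrinsic integers pull back along a morphism with surjective `φ_M` (`φ_M(1 + x) = 1 + φ_M(x)`).
[cite: MochizukiAbsTopIII2015, Definition 3.1 (iii) p.68] -/
theorem Hom.isIntrinsicInteger_of_map (φ : P.Hom Q) (hφ : Function.Surjective φ.homM) {x : P.M}
    (hx : Q.IsIntrinsicInteger (φ.homM x)) : P.IsIntrinsicInteger x := by
  rcases hx with h | h
  · exact Or.inl (φ.isIntrinsicUnit_of_map hφ h)
  · refine Or.inr (φ.isIntrinsicUnit_of_map hφ ?_)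
    rwa [map_add, map_one]

/-- **A `T`-isomorphism of `TF`-pairs restricts to a `T`-isomorphism of the integer pairs**: if `φ_M` is a
(field) isomorphism, then `φ_M|_{𝒪^⊳} : 𝒪₁^⊳ → 𝒪₂^⊳` (abc-iut-L4-t2's `Hom.integers`, Def 3.1 (iii)) is
bijective — so the natural functor `𝒞^MLF_TF → 𝒞^MLF_TM` restricts to the `T`-isomorphism subcategories `𝒞̲`.
(`φ_Π` is NOT assumed to be an isomorphism.) [cite: MochizukiAbsTopIII2015, Definition 3.1 (iii) p.67] -/
theorem Hom.isTIso_integers (φ : P.Hom Q) (hP : IsMLFGaloisFieldPair P) (hQ : IsMLFGaloisFieldPair Q)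
    (hfin : ∀ U : Subgroup P.Pi, IsOpen (U : Set P.Pi) → (U.map φ.homPi ⊔ Q.actionKer).FiniteIndex)
    (h : φ.IsTIso) : (φ.integers hP hQ hfin).IsTIso := by
  refine ⟨fun m m' hmm' => Subtype.ext (φ.homM.injective ?_), fun m => ?_⟩
  · exact congrArg (fun y : (Q.integersPair hQ).M => (y : Q.M)) hmm'
  · obtain ⟨x, hx⟩ := h.2 (m : Q.M)
    have hx0 : x ≠ 0 := by rintro rfl; exact m.2.1 (by rw [← hx, map_zero])
    exact ⟨⟨x, hx0, φ.isIntrinsicInteger_of_map h.2 (by rw [hx]; exact m.2.2)⟩, Subtype.ext hx⟩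

end GaloisFieldPair

/-! ## (f, first half) The E-L4-10 endomorphisms are not `T`-isomorphisms -/

/-- **The squaring endomorphism `(𝟙_Π, x ↦ x²)` of `(Π ↷ 𝒪^⊳)` is NOT a `T`-isomorphism** (it identifies
`-1, 1 ∈ 𝒪^⊳`, distinct in characteristic `0`): the endomorphism by which `Prop32iiiAlgorithm S` (plain `𝒞`) is
uninhabitable (finding E-L4-10, `tfToTMCompact_map_ne_powEnd_two`) is not a morphism of print's carrier `𝒞̲`.
[cite: MochizukiAbsTopIII2015, Definition 3.1 (ii) p.67] -/
theorem not_isTIso_powEnd_two (P : MLFGaloisFieldPairCompactCat.{u}) :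
    ¬ GaloisMonoidPair.Hom.IsTIso ((tfToTMCompact.obj P).obj.powEnd 2) := by
  intro h
  haveI := GaloisFieldPair.charZero_of_isMLFGaloisFieldPair (P := P.obj) P.property.1
  have hm := GaloisFieldPair.neg_one_mem_intrinsicNonzeroIntegers (P := P.obj) P.property.1
  have h1 : (⟨-1, hm⟩ : (tfToTMCompact.obj P).obj.M) = 1 := by
    apply h.1
    apply Subtype.ext
    change ((-1 : P.obj.M)) ^ 2 = ((1 : P.obj.M)) ^ 2
    rw [neg_one_sq, one_pow]
  exact (neg_ne_self.mpr (one_ne_zero : (1 : P.obj.M) ≠ 0)) (congrArg Subtype.val h1)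

/-! ## (b) The carrier: `𝒞̲^{S}_TF`, `𝒞̲^{S}_TM` and the restricted natural functor -/

variable (S : ObjectProperty MLFGaloisFieldPairCompactCat.{u})

/-- The morphism property "`T`-isomorphism" on the `S`-pairs (abc-iut-L4-t2's `GaloisFieldPair.tIso` pulled
back along the inclusion `𝒞^{S}_TF ⥤` all `TF`-pairs). [cite: MochizukiAbsTopIII2015, Definition 3.1 (iii) p.67] -/
abbrev tfTIsoOn : MorphismProperty S.FullSubcategory :=
  GaloisFieldPair.tIso.{u}.inverseImage (S.ι ⋙ MLFGaloisFieldPairCompactCat.incl)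

/-- The morphism property "`T`-isomorphism" on "`𝒞^{MLF-S}_TM`" (the integer pairs of `S`-pairs, up to
isomorphism: `tmPairsOf S`). [cite: MochizukiAbsTopIII2015, Definition 3.1 (iii) p.67] -/
abbrev tmTIsoOn : MorphismProperty (tmPairsOf S).FullSubcategory :=
  GaloisMonoidPair.tIso.{u}.inverseImage ((tmPairsOf S).ι ⋙ MLFGaloisMonoidPairCompactCat.incl .TM)

/-- **`𝒞̲^{MLF-S}_TF`**: the wide subcategory of the `S`-pairs "determined by the `T`-isomorphisms" (`φ_M` a
field isomorphism, `φ_Π` continuous inducing an open injection of arithmetic Galois groups) — print's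
`𝒞̲^{MLF-sB}_TF` for `S` = "of strictly Belyi type". [cite: MochizukiAbsTopIII2015, Definition 3.1 (iii) p.67] -/
abbrev MLFGaloisFieldPairTIsoCatOn : Type (u + 1) := WideSubcategory (tfTIsoOn S)

/-- **`𝒞̲^{MLF-S}_TM`**: the wide subcategory of "`𝒞^{MLF-S}_TM`" determined by the `T`-isomorphisms
(`φ_M : 𝒪₁^⊳ ⥲ 𝒪₂^⊳` a monoid isomorphism, `φ_Π` open-injective-inducing).
[cite: MochizukiAbsTopIII2015, Definition 3.1 (iii) p.67] -/
abbrev MLFGaloisTMPairTIsoCatOn : Type (u + 1) := WideSubcategory (tmTIsoOn S)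

/-- The inclusion `𝒞̲^{S}_TF ⥤ 𝒞^{S}_TF`. [cite: MochizukiAbsTopIII2015, Definition 3.1 (iii) p.67] -/
def MLFGaloisFieldPairTIsoCatOn.ι : MLFGaloisFieldPairTIsoCatOn S ⥤ S.FullSubcategory :=
  wideSubcategoryInclusion _

/-- The inclusion `𝒞̲^{S}_TM ⥤ 𝒞^{S}_TM`. [cite: MochizukiAbsTopIII2015, Definition 3.1 (iii) p.67] -/
def MLFGaloisTMPairTIsoCatOn.ι : MLFGaloisTMPairTIsoCatOn S ⥤ (tmPairsOf S).FullSubcategory :=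
  wideSubcategoryInclusion _

/-- An ISOMORPHISM of "`𝒞^{S}_TM`" is a `T`-isomorphism (abc-iut-L4-t2's `GaloisMonoidPair.tIso_of_isIso`,
transported along the inclusion into all pairs): `Core ⊆ 𝒞̲`. [cite: MochizukiAbsTopIII2015, Definition 3.1 (iii) p.67] -/
theorem tmTIsoOn_of_isIso {X Y : (tmPairsOf S).FullSubcategory} (f : X ⟶ Y) [IsIso f] : tmTIsoOn S f :=
  GaloisMonoidPair.tIso_of_isIso (((tmPairsOf S).ι ⋙ MLFGaloisMonoidPairCompactCat.incl .TM).map f)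

/-- **The natural functor `𝒞̲^{MLF-S}_TF → 𝒞̲^{MLF-S}_TM`, `(Π ↷ M) ↦ (Π ↷ 𝒪^⊳)`, on the `T`-isomorphism
subcategories** — the restriction of the natural functor of Def 3.1 (iii) (`tfToTMOn S`), well defined by
`GaloisFieldPair.Hom.isTIso_integers`; "the first arrow" of the 1-factorization of Prop 3.2 (v) for `T = TM`,
on print's carrier. [cite: MochizukiAbsTopIII2015, Proposition 3.2 (v) p.72] -/
def tfToTMOnTIso : MLFGaloisFieldPairTIsoCatOn S ⥤ MLFGaloisTMPairTIsoCatOn S where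
  obj X := ⟨(tfToTMOn S).obj X.obj⟩
  map {X Y} f := ⟨(tfToTMOn S).map f.hom,
    GaloisFieldPair.Hom.isTIso_integers (P := X.obj.obj.obj) (Q := Y.obj.obj.obj) f.hom.hom.hom
      X.obj.obj.property.1 Y.obj.obj.property.1
      (fun U hU => by
        haveI := Y.obj.obj.property.2
        exact GaloisFieldPair.Hom.finiteIndex_sat_of_compactSpace
          (P := X.obj.obj.obj) (Q := Y.obj.obj.obj) f.hom.hom.hom U hU)
      f.property⟩
  map_id X := by apply WideSubcategory.hom_ext; exact (tfToTMOn S).map_id X.obj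
  map_comp f g := by apply WideSubcategory.hom_ext; exact (tfToTMOn S).map_comp f.hom g.hom

/-- **`𝒞̲^{S}_TF → 𝒞̲^{S}_TM` is faithful**, for every `S` (unconditional; from `tfToTMOn_faithful`).
[cite: MochizukiAbsTopIII2015, Proposition 3.2 (v) p.72] -/
theorem tfToTMOnTIso_faithful : (tfToTMOnTIso S).Faithful := by
  haveI := tfToTMOn_faithful.{u} S
  refine ⟨fun {X Y} => fun f g h => ?_⟩
  apply WideSubcategory.hom_ext
  have h' : (tfToTMOn S).map f.hom = (tfToTMOn S).map g.hom := congrArg InducedWideCategory.Hom.hom h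
  exact (tfToTMOn S).map_injective h'

/-- **`𝒞̲^{S}_TF → 𝒞̲^{S}_TM` is essentially surjective**, for every `S` (unconditional: an object of
"`𝒞^{S}_TM`" is isomorphic to the integers of an `S`-pair, and an isomorphism is a `T`-isomorphism).
[cite: MochizukiAbsTopIII2015, Proposition 3.2 (v) p.72] -/
theorem tfToTMOnTIso_essSurj : (tfToTMOnTIso S).EssSurj := by
  haveI := tfToTMOn_essSurj.{u} S
  refine ⟨fun Q => ?_⟩
  obtain ⟨P, ⟨i⟩⟩ := Functor.EssSurj.mem_essImage (F := tfToTMOn S) Q.obj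
  refine ⟨⟨P⟩, ⟨{ hom := ⟨i.hom, tmTIsoOn_of_isIso S i.hom⟩,
                  inv := ⟨i.inv, tmTIsoOn_of_isIso S i.inv⟩,
                  hom_inv_id := ?_,
                  inv_hom_id := ?_ }⟩⟩
  · apply WideSubcategory.hom_ext; exact i.hom_inv_id
  · apply WideSubcategory.hom_ext; exact i.inv_hom_id

/-! ## (c) Prop 3.2 (iii)/(v): "the algorithm of (iii)", functorial relative to `𝒞̲`, as a parameter -/

/-- **Prop 3.2 (iii)/(v): "the algorithm of (iii)" on the `S`-pairs, functorial "relative to `𝒞̲^MLF_T`, in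
the evident sense", as DATA** — a PARAMETER, NOT constructed and NOT asserted to exist: a functor
`R : 𝒞̲^{MLF-S}_TM → 𝒞̲^{MLF-S}_TF`, `(Π ↷ 𝒪^⊳) ↦ (Π ↷ k̄_reconstructed)`, defined on `T`-isomorphisms
`(φ_Π, φ_M : 𝒪₁^⊳ ⥲ 𝒪₂^⊳)` with `φ_Π` an arbitrary continuous homomorphism inducing an open injection of
arithmetic Galois groups (functoriality "up to the index", Rmk 3.2.2), such that the field reconstructed from
the integers of a `TF`-pair IS that pair (`unitIso`) and the integers of the reconstructed field are the given
monoid (`counitIso`), naturally in `𝒞̲`.  For `S` = "of strictly Belyi type" this is [AbsTopIII] Cor 1.10 (h)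
with Rmk 1.10.1 (campaign L); `nonempty_prop32iiiAlgorithmTIso_iff_full` says exactly what it amounts to; it
implies the `Core` datum `Prop32iiiAlgorithmIso S`. [cite: MochizukiAbsTopIII2015, Proposition 3.2 (iii) p.72] -/
structure Prop32iiiAlgorithmTIso : Type (u + 1) where
  /-- "the algorithm of (iii)" on `T`-isomorphisms: `(Π ↷ 𝒪^⊳) ↦ (Π ↷ k̄_reconstructed)`. -/
  R : MLFGaloisTMPairTIsoCatOn S ⥤ MLFGaloisFieldPairTIsoCatOn S
  /-- (iii) recovers `k̄` from `(Π ↷ k̄)`'s integers, naturally in `T`-isomorphisms. -/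
  unitIso : tfToTMOnTIso S ⋙ R ≅ 𝟭 _
  /-- the integers of the reconstructed field are the given monoid, naturally in `T`-isomorphisms. -/
  counitIso : R ⋙ tfToTMOnTIso S ≅ 𝟭 _

namespace Prop32iiiAlgorithmTIso

variable {S}

/-- **Prop 3.2 (v) on print's carrier: `𝒞̲^{MLF-S}_TF ≌ 𝒞̲^{MLF-S}_TM`** — the natural functor and the
algorithm of (iii) are mutually quasi-inverse (Mathlib's `Equivalence.mk` adjusts the unit).
[cite: MochizukiAbsTopIII2015, Proposition 3.2 (v) p.72] -/
def equivalence (A : Prop32iiiAlgorithmTIso.{u} S) :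
    MLFGaloisFieldPairTIsoCatOn S ≌ MLFGaloisTMPairTIsoCatOn S :=
  CategoryTheory.Equivalence.mk (tfToTMOnTIso S) A.R A.unitIso.symm A.counitIso

/-- Given the algorithm of (iii), `𝒞̲^{S}_TF → 𝒞̲^{S}_TM` is an equivalence of categories.
[cite: MochizukiAbsTopIII2015, Proposition 3.2 (v) p.72] -/
theorem isEquivalence_tfToTMOnTIso (A : Prop32iiiAlgorithmTIso.{u} S) : (tfToTMOnTIso S).IsEquivalence :=
  Functor.IsEquivalence.mk' A.R A.unitIso.symm A.counitIso

/-- In particular, given the algorithm of (iii), `𝒞̲^{S}_TF → 𝒞̲^{S}_TM` is FULL: every `T`-isomorphism of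
the integer pairs extends to the fields. [cite: MochizukiAbsTopIII2015, Proposition 3.2 (v) p.72] -/
theorem full (A : Prop32iiiAlgorithmTIso.{u} S) : (tfToTMOnTIso S).Full :=
  haveI := A.isEquivalence_tfToTMOnTIso
  inferInstance

/-- **Prop 3.2 (v), `𝔩𝔬𝔤_{TM,TF} : 𝒞̲^{S}_TM → 𝒞_TF`** := (algorithm of (iii)) ⋙ `𝔩𝔬𝔤_{TF,TF}` (target the plain
category, as displayed; `𝔩𝔬𝔤_{TF,TF} = 𝟭` in the lineage's log-coordinates, `mlfLogFrobeniusTFIsoId`).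
[cite: MochizukiAbsTopIII2015, Proposition 3.2 (v) p.72] -/
def mlfLogFrobeniusTMToTF (A : Prop32iiiAlgorithmTIso.{u} S) :
    MLFGaloisTMPairTIsoCatOn S ⥤ MLFGaloisFieldPairCompactCat.{u} :=
  A.R ⋙ MLFGaloisFieldPairTIsoCatOn.ι S ⋙ S.ι ⋙ mlfLogFrobeniusTF

/-- **Prop 3.2 (v), `𝔩𝔬𝔤_{TM,TM} : 𝒞̲^{S}_TM → 𝒞̲^{S}_TM`** := (algorithm of (iii)) ⋙ `𝔩𝔬𝔤_{TF,TM}` (in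
log-coordinates `𝔩𝔬𝔤_{TF,TM}|_S` = the natural functor). [cite: MochizukiAbsTopIII2015, Proposition 3.2 (v) p.72] -/
def mlfLogFrobeniusTMToTM (A : Prop32iiiAlgorithmTIso.{u} S) :
    MLFGaloisTMPairTIsoCatOn S ⥤ MLFGaloisTMPairTIsoCatOn S :=
  A.R ⋙ tfToTMOnTIso S

/-- **Prop 3.2 (v), `𝔩𝔬𝔤_{TM,TLG} : 𝒞̲^{S}_TM → 𝒞_TLG`** := (algorithm of (iii)) ⋙ `𝔩𝔬𝔤_{TF,TLG}`.
[cite: MochizukiAbsTopIII2015, Proposition 3.2 (v) p.72] -/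
def mlfLogFrobeniusTMToTLG (A : Prop32iiiAlgorithmTIso.{u} S) :
    MLFGaloisTMPairTIsoCatOn S ⥤ MLFGaloisMonoidPairCompactCat.{u} .TLG :=
  A.R ⋙ MLFGaloisFieldPairTIsoCatOn.ι S ⋙ S.ι ⋙ mlfLogFrobeniusTFToTLG

/-- **Prop 3.2 (v), `𝔩𝔬𝔤_{TM,TCG} : 𝒞̲^{S}_TM → 𝒞_TCG`** := (algorithm of (iii)) ⋙ `𝔩𝔬𝔤_{TF,TCG}`.
[cite: MochizukiAbsTopIII2015, Proposition 3.2 (v) p.72] -/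
def mlfLogFrobeniusTMToTCG (A : Prop32iiiAlgorithmTIso.{u} S) :
    MLFGaloisTMPairTIsoCatOn S ⥤ MLFGaloisMonoidPairCat.{u} .TCG :=
  A.R ⋙ MLFGaloisFieldPairTIsoCatOn.ι S ⋙ S.ι ⋙ mlfLogFrobeniusTFToTCG

/-- **Prop 3.2 (v), the 1-factorization for `T′ = TF`**: `𝔩𝔬𝔤_{TF,TF}|_S ≅ (𝒞̲_TF → 𝒞̲_TM) ⋙ 𝔩𝔬𝔤_{TM,TF}`.
[cite: MochizukiAbsTopIII2015, Proposition 3.2 (v) p.72] -/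
def factorTF (A : Prop32iiiAlgorithmTIso.{u} S) :
    MLFGaloisFieldPairTIsoCatOn.ι S ⋙ S.ι ⋙ mlfLogFrobeniusTF.{u} ≅ tfToTMOnTIso S ⋙ A.mlfLogFrobeniusTMToTF :=
  (Functor.leftUnitor _).symm ≪≫ Functor.isoWhiskerRight A.unitIso.symm _ ≪≫ Functor.associator _ _ _

/-- **Prop 3.2 (v), the 1-factorization for `T′ = TM`**: `𝔩𝔬𝔤_{TF,TM}|_S ≅ (𝒞̲_TF → 𝒞̲_TM) ⋙ 𝔩𝔬𝔤_{TM,TM}`.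
[cite: MochizukiAbsTopIII2015, Proposition 3.2 (v) p.72] -/
def factorTM (A : Prop32iiiAlgorithmTIso.{u} S) : tfToTMOnTIso S ≅ tfToTMOnTIso S ⋙ A.mlfLogFrobeniusTMToTM :=
  (Functor.leftUnitor _).symm ≪≫ Functor.isoWhiskerRight A.unitIso.symm _ ≪≫ Functor.associator _ _ _

/-- **Prop 3.2 (v), the 1-factorization for `T′ = TLG`**: `𝔩𝔬𝔤_{TF,TLG}|_S ≅ (𝒞̲_TF → 𝒞̲_TM) ⋙ 𝔩𝔬𝔤_{TM,TLG}`.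
[cite: MochizukiAbsTopIII2015, Proposition 3.2 (v) p.72] -/
def factorTLG (A : Prop32iiiAlgorithmTIso.{u} S) :
    MLFGaloisFieldPairTIsoCatOn.ι S ⋙ S.ι ⋙ mlfLogFrobeniusTFToTLG.{u} ≅
      tfToTMOnTIso S ⋙ A.mlfLogFrobeniusTMToTLG :=
  (Functor.leftUnitor _).symm ≪≫ Functor.isoWhiskerRight A.unitIso.symm _ ≪≫ Functor.associator _ _ _

/-- **Prop 3.2 (v), the 1-factorization for `T′ = TCG`**: `𝔩𝔬𝔤_{TF,TCG}|_S ≅ (𝒞̲_TF → 𝒞̲_TM) ⋙ 𝔩𝔬𝔤_{TM,TCG}`.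
[cite: MochizukiAbsTopIII2015, Proposition 3.2 (v) p.72] -/
def factorTCG (A : Prop32iiiAlgorithmTIso.{u} S) :
    MLFGaloisFieldPairTIsoCatOn.ι S ⋙ S.ι ⋙ mlfLogFrobeniusTFToTCG.{u} ≅
      tfToTMOnTIso S ⋙ A.mlfLogFrobeniusTMToTCG :=
  (Functor.leftUnitor _).symm ≪≫ Functor.isoWhiskerRight A.unitIso.symm _ ≪≫ Functor.associator _ _ _

/-- **Prop 3.2 (v): "the functor `𝔩𝔬𝔤_{T,T}` is isomorphic to the identity functor"** for `T = TM`, on print's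
carrier `𝒞̲` (the counit of the algorithm of (iii)). [cite: MochizukiAbsTopIII2015, Proposition 3.2 (v) p.72] -/
def mlfLogFrobeniusTMToTMIsoId (A : Prop32iiiAlgorithmTIso.{u} S) : A.mlfLogFrobeniusTMToTM ≅ 𝟭 _ :=
  A.counitIso

/-- **Prop 3.2 (v): "hence, in particular, [`𝔩𝔬𝔤_{TM,TM}`] is an equivalence of categories"** (on `𝒞̲`).
[cite: MochizukiAbsTopIII2015, Proposition 3.2 (v) p.72] -/
theorem isEquivalence_mlfLogFrobeniusTMToTM (A : Prop32iiiAlgorithmTIso.{u} S) :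
    A.mlfLogFrobeniusTMToTM.IsEquivalence :=
  Functor.isEquivalence_of_iso A.mlfLogFrobeniusTMToTMIsoId.symm

end Prop32iiiAlgorithmTIso

/-! ## (d) What the parameter amounts to: fullness of `𝒞̲^{S}_TF → 𝒞̲^{S}_TM` -/

variable {S} in
/-- **From fullness to the algorithm of (iii) on `𝒞̲`**: if every `T`-isomorphism of the integer pairs between
`S`-pairs extends to the fields, then — `tfToTMOnTIso S` being faithful and essentially surjective
unconditionally — it is an equivalence and its quasi-inverse IS a `Prop32iiiAlgorithmTIso S`.
[cite: MochizukiAbsTopIII2015, Proposition 3.2 (v) p.72] -/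
def Prop32iiiAlgorithmTIso.ofFull (h : (tfToTMOnTIso S).Full) : Prop32iiiAlgorithmTIso.{u} S :=
  haveI := h
  haveI := tfToTMOnTIso_faithful.{u} S
  haveI := tfToTMOnTIso_essSurj.{u} S
  haveI : (tfToTMOnTIso S).IsEquivalence := {}
  { R := (tfToTMOnTIso S).asEquivalence.inverse
    unitIso := (tfToTMOnTIso S).asEquivalence.unitIso.symm
    counitIso := (tfToTMOnTIso S).asEquivalence.counitIso }

/-- **THE RESIDUAL OF Prop 3.2 (iii)/(v) ON PRINT'S CARRIER, kernel-pinned**: the algorithm of (iii) exists as a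
datum functorial "relative to `𝒞̲`" on the `S`-pairs IFF `𝒞̲^{S}_TF → 𝒞̲^{S}_TM` is FULL — "every `T`-isomorphism
`(φ_Π, φ_M : 𝒪^⊳ ⥲ 𝒪′^⊳) : (Π ↷ 𝒪^⊳) → (Π′ ↷ 𝒪′^⊳)` between `S`-pairs, `φ_Π` merely inducing an open injection
of arithmetic Galois groups, extends to a field isomorphism compatible with `φ_Π`".  For `S` = strictly Belyi
type print obtains this from Cor 1.10 (h) and Rmk 1.10.1 (campaign L; NOT asserted here).
[cite: MochizukiAbsTopIII2015, Proposition 3.2 (v) p.72] -/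
theorem nonempty_prop32iiiAlgorithmTIso_iff_full :
    Nonempty (Prop32iiiAlgorithmTIso.{u} S) ↔ (tfToTMOnTIso S).Full :=
  ⟨fun ⟨A⟩ => A.full, fun h => ⟨Prop32iiiAlgorithmTIso.ofFull h⟩⟩

/-! ## (e) One-way comparison with the `Core` carrier (and hence with F-2995|`S`) -/

/-- **Fullness on `𝒞̲` implies fullness on `Core`**: an isomorphism `(Π ↷ 𝒪^⊳) ⥲ (Π′ ↷ 𝒪′^⊳)` between the
integers of `S`-pairs is a `T`-isomorphism, so it lifts to a `𝒞̲`-morphism of the fields, which is an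
isomorphism because `tfToTMOn S` reflects isomorphisms.  (THE CONVERSE IS NOT CLAIMED: `𝒞̲`-fullness also
covers non-surjective `φ_Π`, Rmk 3.2.2.) [cite: MochizukiAbsTopIII2015, Proposition 3.2 (iv) p.72] -/
theorem full_tfToTMOnCore_of_full_tfToTMOnTIso (h : (tfToTMOnTIso S).Full) : (tfToTMOnCore S).Full := by
  haveI := h
  haveI := tfToTMOn_reflectsIsomorphisms.{u} S
  refine ⟨fun {X Y} f => ?_⟩
  let X' : MLFGaloisFieldPairTIsoCatOn S := ⟨X.of⟩
  let Y' : MLFGaloisFieldPairTIsoCatOn S := ⟨Y.of⟩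
  let i : (tfToTMOn S).obj X.of ≅ (tfToTMOn S).obj Y.of := f.iso
  let f' : (tfToTMOnTIso S).obj X' ⟶ (tfToTMOnTIso S).obj Y' := ⟨i.hom, tmTIsoOn_of_isIso S i.hom⟩
  obtain ⟨g, hg⟩ := (tfToTMOnTIso S).map_surjective f'
  have hg' : (tfToTMOn S).map g.hom = i.hom := congrArg InducedWideCategory.Hom.hom hg
  haveI : IsIso ((tfToTMOn S).map g.hom) := by rw [hg']; infer_instance
  haveI : IsIso g.hom := isIso_of_reflects_iso g.hom (tfToTMOn S)
  refine ⟨CoreHom.mk (asIso g.hom), ?_⟩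
  apply Core.hom_ext
  exact hg'

/-- Hence **an algorithm of (iii) functorial on `𝒞̲` restricts to one functorial on `Core`** (the lineage's
`Prop32iiiAlgorithmIso S`, via the two fullness residuals). [cite: MochizukiAbsTopIII2015, Proposition 3.2 (v) p.72] -/
theorem nonempty_prop32iiiAlgorithmIso_of_nonempty_prop32iiiAlgorithmTIso
    (h : Nonempty (Prop32iiiAlgorithmTIso.{u} S)) : Nonempty (Prop32iiiAlgorithmIso.{u} S) :=
  (nonempty_prop32iiiAlgorithmIso_iff_full S).mpr
    (full_tfToTMOnCore_of_full_tfToTMOnTIso S ((nonempty_prop32iiiAlgorithmTIso_iff_full S).mp h))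

/-- **Fullness on print's carrier `𝒞̲^{S}` implies the `TF` bijectivity schema of Prop 3.2 (iv) on `S`** (F-2995
`GaloisIsoLiftsToTFPairIsoOfStrictlyBelyi` at the inline predicate "MLF-Galois with compact `Π`, in `S`"; universe
`0`), through `full_tfToTMOnCore_iff_galoisIsoLiftsToTFPairIso`.  One way only. [cite: MochizukiAbsTopIII2015, Proposition 3.2 (iv) p.72] -/
theorem galoisIsoLiftsToTFPairIso_of_full_tfToTMOnTIso
    (S : ObjectProperty MLFGaloisFieldPairCompactCat.{0}) (h : (tfToTMOnTIso S).Full) :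
    GaloisIsoLiftsToTFPairIsoOfStrictlyBelyi
      (fun P => ∃ hP : IsMLFGaloisFieldPair P ∧ CompactSpace P.Pi, S ⟨P, hP⟩) :=
  (full_tfToTMOnCore_iff_galoisIsoLiftsToTFPairIso S).mp (full_tfToTMOnCore_of_full_tfToTMOnTIso S h)

/-- **An algorithm of (iii) functorial on `𝒞̲^{S}` implies F-2995|`S`** (universe `0`).  One way only.
[cite: MochizukiAbsTopIII2015, Proposition 3.2 (iv) p.72] -/
theorem galoisIsoLiftsToTFPairIso_of_nonempty_prop32iiiAlgorithmTIso
    (S : ObjectProperty MLFGaloisFieldPairCompactCat.{0}) (h : Nonempty (Prop32iiiAlgorithmTIso S)) :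
    GaloisIsoLiftsToTFPairIsoOfStrictlyBelyi
      (fun P => ∃ hP : IsMLFGaloisFieldPair P ∧ CompactSpace P.Pi, S ⟨P, hP⟩) :=
  galoisIsoLiftsToTFPairIso_of_full_tfToTMOnTIso S ((nonempty_prop32iiiAlgorithmTIso_iff_full S).mp h)

/-! ## (f, second half) The E-L4-10 endomorphism is not a morphism of `𝒞̲^{S}_TM` -/

/-- **The E-L4-10 endomorphism `(𝟙_Π, x ↦ x²)` of the integers of an `S`-pair — the morphism by which `tfToTMOn S`
fails to be full (`not_full_tfToTMOn`) — is not a morphism of `𝒞̲^{S}_TM`**: the obstruction to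
`Prop32iiiAlgorithm S` is absent from print's carrier. [cite: MochizukiAbsTopIII2015, Proposition 3.2 (v) p.72] -/
theorem not_tmTIsoOn_powEnd_two (X : S.FullSubcategory) :
    ¬ tmTIsoOn S (X := (tfToTMOn S).obj X) (Y := (tfToTMOn S).obj X)
      (InducedCategory.homMk (InducedCategory.homMk ((tfToTMCompact.obj X.obj).obj.powEnd 2))) :=
  not_isTIso_powEnd_two X.obj

end Literature.AnabelianGeometry.AbsoluteAnabelian

end
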